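import Mathlib
import HarnessLib
import Summits.HubbardSuperconductivity.HubbardSuperconductivity.Theorems.KLProgrammePairTransferOutClassN4PathRow
import Summits.HubbardSuperconductivity.HubbardSuperconductivity.Theorems.KLProgrammeKLRegimeEnginePairTransferOutClassFrameWindowRegime
import Summits.HubbardSuperconductivity.HubbardSuperconductivity.Theorems.KLProgrammeKLRegimeEnginePairTransferOutClassHoutRegime
import Summits.HubbardSuperconductivity.HubbardSuperconductivity.Theorems.KLProgrammeKLRegimeEnginePairTransferOutClassCapShares
import Summits.HubbardSuperconductivity.HubbardSuperconductivity.Theorems.KLProgrammeKLRegimeEnginePairTransferOutClassAssemblyG14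
import Summits.HubbardSuperconductivity.HubbardSuperconductivity.Theorems.KLProgrammeKLRegimeEnginePairTransferOutClassFrameShiftSizesGeom
import Summits.HubbardSuperconductivity.HubbardSuperconductivity.Theorems.KLProgrammeKLRegimeEngineV8PairTransferExport8
import Summits.HubbardSuperconductivity.HubbardSuperconductivity.Theorems.KLProgrammeKLRegimeEngineSymbolThresholds
import Summits.HubbardSuperconductivity.HubbardSuperconductivity.Theorems.KLProgrammeKLRegimeEngineTwoLegReadDriverHist
import Summits.HubbardSuperconductivity.HubbardSuperconductivity.Theorems.KLProgrammeKLRegimeEngineV8DefsU12bGQ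
import Summits.HubbardSuperconductivity.HubbardSuperconductivity.Theorems.KLProgrammeKLRegimeEngineV8DefsQ9dG
import Summits.HubbardSuperconductivity.HubbardSuperconductivity.Theorems.KLProgrammeKLRegimeEngineV8DefsValU
import Summits.HubbardSuperconductivity.HubbardSuperconductivity.Theorems.KLProgrammeKLRegimeEngineStepValuesResidueV17F2G

/-!
# K3 ENGINE (stmt-HubbardSuperconductivity-20437 `KLRegimeEngineV17F2`, V2 registration 27cd7ed0f55f17c0), row (c) `stub_engine_step_values`:
# THE REGISTRANT / REGIME DOORS OF THE OUT-OF-CLASS HEAD, DISCHARGED UNDER ROW (c)'s OWN BINDERS AT `(G, klEngQ9dG G P R)`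
# (cell gate-hubbard-kl, seat hubbard-kl-k3c2-p2 g24 = the (c) value-lane closer lineage; sequel of `…EngineV17F2ClosersVGQ`)

WHY.  `…EngineV17F2ClosersVGQ` (p711453) credits row (c) modulo three residual rows, the middle one being the OUT-OF-CLASS half of (E2″-F)ₙ (`hexOut`).  Its producer of
record is this lane's head `KLRegimeSplit.outClass_hout_klEngGeo14_of_shares_of_raw_split3` (…PairTransferOutClassHoutG14Split3, ≈ 95 binders).  Besides E1's model rows
((N₄-PATH), RH/RL, the (E4)-DRESSED-SPLIT data and sizes, the self-energy data, `Z ≠ 0`), the class-#5 relative datum and the frame-shift binder (p2's `hshift_succ_of_sizes_geom`),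
that head carries REGISTRANT / REGIME DOORS.  This file discharges every one of them from row (c)'s binder prefix at the V2 tokens (`c ≤ klEngC₃7GU G P R`,
`U ≤ klEngU₀12GQ G (klEngQ9dG G P R) P R c`, `klBetaMin ≤ β ≤ e^{c/U²}`, `klEngL₄ P R β U ≤ L`, `klEngM₃ β U L ≤ M`, `μ ∈ klWindowC`, the history at `n + 1`), one lemma per door:
* §1 scalar doors: `rowC_hUu` (`U ≤ klTSU R`), `rowC_hGU` (`8/3·Gfr₁U² ≤ 1`), `rowC_hGL` (`8(4 + 8/3·Gfr₁U²)β ≤ L`), `rowC_klam_mul_le` (`Klam·U ≤ 1/(3·2²⁰)`, `(Klam U)² ≤ 1`),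
  `rowC_hTU` (`2²⁶·klTS·Klam|U| ≤ 1`), `rowC_hQCR` / `rowC_hQCL` (the `Q`-floors `2⁶⁰Psq²Rsq²(·(β²+1)4ⁿ)` at `Q = klEngQ9dG G P R`), `rowC_hcU'` («(c)-HCU-QCR» at the V2 token),
  `rowC_beta_le_M`;
* §2 the lower frame `Kₙ` is admissible from the history at `n + 1` (`rowC_frameOK_lower`), and **`rowC_frameWindow`** — the seven frame-window facts of the signed rows
  (`hAb`, `4Af < B.Dtmin`, `4Af ≤ 1/20`, `μ ≤ −0.15`, the shell window, the Matsubara count) at `B := bandBounds (−6/5) (−1/10)`, `Af := 2Gfr₀|U| + 2Gfr₁U² + Gfr₂·c/log 4`, the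
  thresholds of `signedRows_frameWindow_of_regime` DISCHARGED from `c ≤ klEngC₃3`, `U ≤ klEngU₀3` (`cDtmin_engineWindow_ge : 33/100 ≤ Dtmin`);
* §3 **`rowC_pairArray_apriori`** — the a-priori pair-array bound `m′ = 2|U| + D·U²` (`D = C_W + klLegKappa·Q.CR·Klam³`), `m′² ≤ 2⁸(Klam U)²`, from the (B1-F) array of the
  history and the value lane's smallness line — and `rowC_hsm` (un-smearing smallness, `unsmear_smallness_of_le`);
* §4 **`rowC_hE_klEngGeo14`** — the erem host line `2·¼·eremBar klEngGeo11 P Q … n + E₂(klCT8) ≤ eremBar klEngGeo14 P Q … n` at `Q = klEngQ9dG klEngGeo14 P R` (`hout_hE_cap_of_U` with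
  the u-slot `klCTu8T` and the `Q`-floors; `eremBar_klEngGeo14_eq`).
Arithmetic over landed doors; no definitions; nothing about the model is asserted; nothing here asserts (c), any open row of 20437, K3 or superconductivity.  0 kit · 0 lit.
-/

noncomputable section

namespace Summit.HubbardSuperconductivity.HubbardSuperconductivity.Theorems.EngineV8

set_option linter.dupNamespace false -- summit = problem name (single-conjunct summit), D-0017

open Real Set Finset Literature.MathematicalPhysics.QuantumLattice Literature.Probability.LatticeModels
open Literature.MathematicalPhysics.QuantumLattice.BandSectorCounting
open Summit.HubbardSuperconductivity.HubbardSuperconductivity.Theorems.KLProgrammeLegKernels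
open Summit.HubbardSuperconductivity.HubbardSuperconductivity.Theorems.DispersionFlow
open Summit.HubbardSuperconductivity.HubbardSuperconductivity.Theorems.KLRegimeSplit

/-! ## §1 Scalar doors -/

section Scalar

variable (G : GeoConsts) {P : SplitConsts} {R : RenConsts} {c μ U β : ℝ} {L M : ℕ}

/-- `U ≤ klTSU R` (token #14 at `(G, Q)`). -/
theorem rowC_hUu {Q : EngConsts} (hUle : U ≤ klEngU₀12GQ G Q P R c) : U ≤ klTSU R := hUle.trans (klEngU₀12GQ_le_klTSU G Q P R c)

/-- `0 ≤ 8/3·Gfr₁U² ≤ 1` (p1 g24's `gfr_one_mul_sq_le_one_of_le_klEngU₀10` through token #14). -/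
theorem rowC_hGU {Q : EngConsts} (hR : R.WF2) (hU : 0 < U) (hUle : U ≤ klEngU₀12GQ G Q P R c) :
    0 ≤ 8 / 3 * R.Gfr 1 * U ^ 2 ∧ 8 / 3 * R.Gfr 1 * U ^ 2 ≤ 1 :=
  gfr_one_mul_sq_le_one_of_le_klEngU₀10 hR.1 hU (hUle.trans (klEngU₀12GQ_le_klEngU₀10 G Q P R c))

/-- `β ≤ L` and `8·(4 + 8/3·Gfr₁U²)·β ≤ L` (`≤ 40β ≤ 1024β² ≤ klEngL₃ β U ≤ klEngL₄ P R β U ≤ L`, `β ≥ 128`). -/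
theorem rowC_hGL {Q : EngConsts} (hR : R.WF2) (hU : 0 < U) (hUle : U ≤ klEngU₀12GQ G Q P R c) (hβ : klBetaMin ≤ β) (hL : klEngL₄ P R β U ≤ L) :
    β ≤ (L : ℝ) ∧ 8 * (4 + 8 / 3 * R.Gfr 1 * U ^ 2) * β ≤ L := by
  have hGU := rowC_hGU G hR hU hUle
  have hβL : β ≤ (L : ℝ) := le_of_klEngL₄_le hL
  have h3 : (klEngL₃ β U : ℝ) ≤ (L : ℝ) := by exact_mod_cast klEngL₃_le_of_klEngL₄_le hL
  have hsq : 1024 * β ^ 2 ≤ (klEngL₃ β U : ℝ) := sq_beta_le_klEngL₃ β U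
  have hβ128 : (128 : ℝ) ≤ β := le_trans (by norm_num [klBetaMin]) hβ
  refine ⟨hβL, ?_⟩
  nlinarith [hGU.1, hGU.2]

/-- `P.Klam ≤ klEngPsq P` (`x ≤ x² + 1`). -/
theorem klam_le_klEngPsq (P : SplitConsts) : P.Klam ≤ klEngPsq P := by
  unfold klEngPsq; nlinarith [sq_nonneg (P.Klam - 1), sq_nonneg P.C_W, sq_nonneg P.Cd]

/-- **`Klam·U ≤ 2⁻¹²⁰`** below `klEngU₀3` (hence below token #14). -/
theorem klam_mul_le_of_le_klEngU₀3 (hP : P.WF) (hU₀ : U ≤ klEngU₀3 P R c) : P.Klam * U ≤ 1 / (2 : ℝ) ^ 120 := by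
  have hPsq1 : 1 ≤ klEngPsq P := one_le_klEngPsq P
  have hRsq1 : 1 ≤ klEngRsq R := one_le_klEngRsq R
  have hK1 : 1 ≤ P.Klam := hP.1
  have hKP : P.Klam ≤ klEngPsq P := klam_le_klEngPsq P
  have hden : 0 < (2 : ℝ) ^ 120 * klEngPsq P ^ 2 * klEngRsq R ^ 4 * (c ^ 2 + 1) := by positivity
  have hU' : U ≤ 1 / ((2 : ℝ) ^ 120 * klEngPsq P ^ 2 * klEngRsq R ^ 4 * (c ^ 2 + 1)) := hU₀
  -- `Klam·U ≤ Klam / (2^120 Psq² Rsq⁴ (c²+1)) ≤ 1/2^120`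
  have h1 : P.Klam * U ≤ P.Klam * (1 / ((2 : ℝ) ^ 120 * klEngPsq P ^ 2 * klEngRsq R ^ 4 * (c ^ 2 + 1))) :=
    mul_le_mul_of_nonneg_left hU' (by linarith)
  refine h1.trans ?_
  rw [mul_one_div, div_le_div_iff₀ hden (by positivity), one_mul]
  have hR4 : 1 ≤ klEngRsq R ^ 4 := one_le_pow₀ hRsq1
  have hc1 : 1 ≤ c ^ 2 + 1 := by nlinarith [sq_nonneg c]
  have hP2 : P.Klam ≤ klEngPsq P ^ 2 := by nlinarith
  calc P.Klam * (2 : ℝ) ^ 120 = (2 : ℝ) ^ 120 * P.Klam * 1 * 1 := by ring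
    _ ≤ (2 : ℝ) ^ 120 * klEngPsq P ^ 2 * klEngRsq R ^ 4 * (c ^ 2 + 1) := by gcongr

/-- **`Klam·U ≤ 1/(3·2²⁰)`, `0 ≤ Klam·U`, `(Klam U)² ≤ 1`** under row (c)'s U-door. -/
theorem rowC_klam_mul_le {Q : EngConsts} (hP : P.WF) (hU : 0 < U) (hUle : U ≤ klEngU₀12GQ G Q P R c) :
    0 ≤ P.Klam * U ∧ P.Klam * U ≤ 1 / (3 * 2 ^ 20) ∧ (P.Klam * U) ^ 2 ≤ 1 := by
  have h := klam_mul_le_of_le_klEngU₀3 hP (hUle.trans (klEngU₀12GQ_le_klEngU₀3 G Q P R c))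
  have h0 : 0 ≤ P.Klam * U := mul_nonneg (zero_le_one.trans hP.1) hU.le
  refine ⟨h0, h.trans (by norm_num), ?_⟩
  have h1 : P.Klam * U ≤ 1 := h.trans (by norm_num)
  nlinarith

/-- **`2²⁶·klTS·(Klam·|U|) ≤ 1`** (the A25 cap's U-side booking, u-slot `klCTu8T` of token #14). -/
theorem rowC_hTU {Q : EngConsts} (hU : 0 < U) (hUle : U ≤ klEngU₀12GQ G Q P R c) : 2 ^ 26 * klTS * (P.Klam * |U|) ≤ 1 :=
  hTU_of_le_klCTu8T hU (hUle.trans (klEngU₀12GQ_le_klCTu8T G Q P R c))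

/-- **The `CR`-floor at `klEngQ9dG G P R`**: `2⁶⁰·Psq²·Rsq² ≤ (klEngQ9dG G P R).CR`. -/
theorem rowC_hQCR (P : SplitConsts) (R : RenConsts) : 2 ^ 60 * klEngPsq P ^ 2 * klEngRsq R ^ 2 ≤ (klEngQ9dG G P R).CR := by
  have h3 : (klEngQ3 P R).CR = 2 ^ 60 * klEngPsq P ^ 2 * klEngRsq R ^ 2 := rfl
  calc 2 ^ 60 * klEngPsq P ^ 2 * klEngRsq R ^ 2 = (klEngQ3 P R).CR := h3.symm
    _ ≤ (klEngQ5 P R).CR := klEngQ3_CR_le_klEngQ5_CR P R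
    _ = (klEngQ7 P R).CR := by rw [klEngQ7_CR, klEngQ6_CR]
    _ ≤ (klEngQ9dG G P R).CR := klEngQ7_CR_le_klEngQ9dG_CR G P R

/-- **The `CL`-floor at `klEngQ9dG G P R`**: `2⁶⁰·Psq²·Rsq²·(β²+1)·4ⁿ ≤ (klEngQ9dG G P R).CL β n` (equality: `CL` is pinned to `klEngQ7`'s). -/
theorem rowC_hQCL (P : SplitConsts) (R : RenConsts) (β : ℝ) (n : ℕ) :
    2 ^ 60 * klEngPsq P ^ 2 * klEngRsq R ^ 2 * (β ^ 2 + 1) * (4 : ℝ) ^ n ≤ (klEngQ9dG G P R).CL β n :=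
  le_of_eq (by rw [klEngQ9dG_CL_apply, klEngQ7_CL_apply])

/-- **«(c)-HCU-QCR» at the V2 token**: `(C_W + klLegKappa·Q.CR·Klam³)·|U| ≤ 1/10`, `Q = klEngQ9dG G P R`. -/
theorem rowC_hcU' (hP : P.WF) (hU : 0 < U) (hUle : U ≤ klEngU₀12GQ G (klEngQ9dG G P R) P R c) :
    (P.C_W + klLegKappa * (klEngQ9dG G P R).CR * P.Klam ^ 3) * |U| ≤ 1 / 10 :=
  hcU_of_le_klValU_wf hP (klEngQ9dG_wf G P R).2.1 hU (hUle.trans (klEngU₀12GQ_le_klValU G _ P R c))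

/-- `β ≤ M` from `klEngM₃ β U L ≤ M` (`β ≤ β² ≤ M`, `β ≥ klBetaMin ≥ 1`). -/
theorem rowC_beta_le_M (hβ : klBetaMin ≤ β) (hM : klEngM₃ β U L ≤ M) : β ≤ (M : ℝ) := by
  have h := (sq_le_of_klEngM₃_le hM).1
  have hβ1 : (1 : ℝ) ≤ β := le_trans (by norm_num [klBetaMin]) hβ
  nlinarith

end Scalar

/-! ## §2 The lower frame and the frame window -/

section Frame

variable (G : GeoConsts) {P : SplitConsts} {Q : EngConsts} {R : RenConsts} {c μ U β : ℝ} {L M : ℕ} [NeZero L] [NeZero M] {n : ℕ}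

/-- **The LOWER frame `Kₙ` is admissible at depth `nScales β`** from the history at `n + 1` (`frameOK_klFlowFrameU_self_of_hist` + `FrameOK.mono`). -/
theorem rowC_frameOK_lower (hR : R.WF2) (hμ : μ ∈ klWindowC) (hn : n ≤ nScales β)
    (hhist : HistP klPredsV17F2 L M G P Q R β U μ 0 (n + 1)) : FrameOK R U (nScales β) μ (klFlowFrameU L M β U μ n) :=
  FrameOK.mono hR.1.2.2 hn (frameOK_klFlowFrameU_self_of_hist hhist hR.1 hμ n (Nat.le_succ n))

/-- The frame-window thresholds of `signedRows_frameWindow_of_regime` HOLD below `klEngC₃3` / `klEngU₀3` (`Dtmin ≥ 33/100 ⇒ κ = 1/40`; `Gfr_j ≤ Rsq`). -/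
theorem frameWindow_thresholds_of_doors (hR : R.WF2) (hc3 : c ≤ klEngC₃3 P R) (hU3 : U ≤ klEngU₀3 P R c) :
    c ≤ min ((bandBounds (show (-4 : ℝ) < -(6 / 5) by norm_num) (show (-(6 / 5) : ℝ) ≤ -(1 / 10) by norm_num)
        (show (-(1 / 10) : ℝ) < 0 by norm_num)).Dtmin / 4) (1 / 40) / (12 * (R.Gfr 2 + 1)) ∧
      U ≤ min 1 (min ((bandBounds (show (-4 : ℝ) < -(6 / 5) by norm_num) (show (-(6 / 5) : ℝ) ≤ -(1 / 10) by norm_num)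
        (show (-(1 / 10) : ℝ) < 0 by norm_num)).Dtmin / 4) (1 / 40) / (24 * (R.Gfr 0 + R.Gfr 1 + 1))) := by
  have hD : (33 : ℝ) / 100 ≤ (bandBounds (show (-4 : ℝ) < -(6 / 5) by norm_num) (show (-(6 / 5) : ℝ) ≤ -(1 / 10) by norm_num)
      (show (-(1 / 10) : ℝ) < 0 by norm_num)).Dtmin := cDtmin_engineWindow_ge
  have hκ : min ((bandBounds (show (-4 : ℝ) < -(6 / 5) by norm_num) (show (-(6 / 5) : ℝ) ≤ -(1 / 10) by norm_num)
      (show (-(1 / 10) : ℝ) < 0 by norm_num)).Dtmin / 4) (1 / 40) = 1 / 40 := min_eq_right (by linarith)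
  rw [hκ]
  have hG0 : 0 ≤ R.Gfr 0 := hR.1.2.2 0
  have hG1 : 0 ≤ R.Gfr 1 := hR.1.2.2 1
  have hG2 : 0 ≤ R.Gfr 2 := hR.1.2.2 2
  have hRsq1 : 1 ≤ klEngRsq R := one_le_klEngRsq R
  have hPsq1 : 1 ≤ klEngPsq P := one_le_klEngPsq P
  have hG0R : R.Gfr 0 ≤ klEngRsq R := gfr_le_klEngRsq R (by norm_num)
  have hG1R : R.Gfr 1 ≤ klEngRsq R := gfr_le_klEngRsq R (by norm_num)
  have hG2R : R.Gfr 2 ≤ klEngRsq R := gfr_le_klEngRsq R (by norm_num)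
  constructor
  · -- `c ≤ 1/(2^120 Psq Rsq²) ≤ 1/(480 (Gfr₂+1))`
    have hc' : c ≤ 1 / ((2 : ℝ) ^ 120 * klEngPsq P * klEngRsq R ^ 2) := hc3
    refine hc'.trans ?_
    rw [div_div, one_div_le_one_div (by positivity) (by positivity)]
    calc (40 : ℝ) * (12 * (R.Gfr 2 + 1)) ≤ 960 * 1 * klEngRsq R ^ 2 := by nlinarith
      _ ≤ (2 : ℝ) ^ 120 * klEngPsq P * klEngRsq R ^ 2 := by gcongr; norm_num
  · have hU' : U ≤ 1 / ((2 : ℝ) ^ 120 * klEngPsq P ^ 2 * klEngRsq R ^ 4 * (c ^ 2 + 1)) := hU3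
    have hden1 : (2880 : ℝ) * klEngRsq R ≤ (2 : ℝ) ^ 120 * klEngPsq P ^ 2 * klEngRsq R ^ 4 * (c ^ 2 + 1) := by
      have hR4 : klEngRsq R ≤ klEngRsq R ^ 4 := by
        calc klEngRsq R = klEngRsq R * 1 * 1 * 1 := by ring
          _ ≤ klEngRsq R * klEngRsq R * klEngRsq R * klEngRsq R := by gcongr
          _ = klEngRsq R ^ 4 := by ring
      have hc1 : (1 : ℝ) ≤ c ^ 2 + 1 := by nlinarith [sq_nonneg c]
      have hP2 : (1 : ℝ) ≤ klEngPsq P ^ 2 := one_le_pow₀ hPsq1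
      calc (2880 : ℝ) * klEngRsq R = 2880 * 1 * klEngRsq R * 1 := by ring
        _ ≤ (2 : ℝ) ^ 120 * klEngPsq P ^ 2 * klEngRsq R ^ 4 * (c ^ 2 + 1) := by gcongr; norm_num
    refine le_min ?_ ?_
    · refine hU'.trans ?_
      rw [div_le_one (by positivity)]
      nlinarith
    · refine hU'.trans ?_
      rw [div_div, one_div_le_one_div (by positivity) (by positivity)]
      nlinarith

omit [NeZero L] [NeZero M] in
/-- **THE SEVEN FRAME-WINDOW FACTS of the signed rows / the (c)-OUT head, under row (c)'s doors** — `signedRows_frameWindow_of_regime` at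
`B := bandBounds (−6/5) (−1/10)`, `Af := 2Gfr₀|U| + 2Gfr₁U² + Gfr₂·c/log 4`, lower frame `Kₙ`: `hAb`, `4Af < B.Dtmin`, `4Af ≤ 1/20`, `μ ≤ −0.15`, the shell window
`−6/5 < μ − 4Λₙ₊₁ − 4Af`, `μ + 4Λₙ₊₁ + 4Af < −1/10`, and `β·4Λₙ₊₁/(2π) + 1 ≤ M`. -/
theorem rowC_frameWindow (hR : R.WF2) (hc : 0 < c) (hc3 : c ≤ klEngC₃7GU G P R) (hμ : μ ∈ klWindowC) (hU : 0 < U)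
    (hUle : U ≤ klEngU₀12GQ G Q P R c) (hβ : klBetaMin ≤ β) (hβc : β ≤ Real.exp (c / U ^ 2)) (hM : klEngM₃ β U L ≤ M)
    {K : TrigPolyC4v} (hK : FrameOK R U (nScales β) μ K) (n : ℕ) :
    (∀ p : Momentum, ∀ j ≤ 2, ‖iteratedFDeriv ℝ j (frameShift K) p‖ ≤ 2 * R.Gfr 0 * |U| + 2 * R.Gfr 1 * U ^ 2 + R.Gfr 2 * (c / Real.log 4)) ∧
      4 * (2 * R.Gfr 0 * |U| + 2 * R.Gfr 1 * U ^ 2 + R.Gfr 2 * (c / Real.log 4)) <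
        (bandBounds (show (-4 : ℝ) < -(6 / 5) by norm_num) (show (-(6 / 5) : ℝ) ≤ -(1 / 10) by norm_num) (show (-(1 / 10) : ℝ) < 0 by norm_num)).Dtmin ∧
      4 * (2 * R.Gfr 0 * |U| + 2 * R.Gfr 1 * U ^ 2 + R.Gfr 2 * (c / Real.log 4)) ≤ 1 / 20 ∧
      μ ≤ -0.15 ∧
      (-(6 / 5) : ℝ) < μ - 4 * klScale klE0 (n + 1) - 4 * (2 * R.Gfr 0 * |U| + 2 * R.Gfr 1 * U ^ 2 + R.Gfr 2 * (c / Real.log 4)) ∧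
      μ + 4 * klScale klE0 (n + 1) + 4 * (2 * R.Gfr 0 * |U| + 2 * R.Gfr 1 * U ^ 2 + R.Gfr 2 * (c / Real.log 4)) < -(1 / 10) ∧
      β * (4 * klScale klE0 (n + 1)) / (2 * Real.pi) + 1 ≤ M := by
  have hc33 : c ≤ klEngC₃3 P R := (hc3.trans (klEngC₃7GU_le_klEngC₃6 G P R)).trans (klEngC₃6_le_klEngC₃3 P R)
  have hU3 : U ≤ klEngU₀3 P R c := hUle.trans (klEngU₀12GQ_le_klEngU₀3 G Q P R c)
  obtain ⟨hcle, hUle'⟩ := frameWindow_thresholds_of_doors (P := P) hR hc33 hU3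
  exact signedRows_frameWindow_of_regime _ _ _ hR.1.2.2 hc hcle hU hUle' hβ hβc hμ hK (rowC_beta_le_M hβ hM) n

end Frame

/-! ## §3 The a-priori pair array at the lower scale and the un-smearing smallness -/

section Apriori

variable {L M : ℕ} [NeZero L] [NeZero M] {P : SplitConsts} {Q : EngConsts} {β U μ : ℝ} {n : ℕ}

/-- **A-PRIORI PAIR ARRAY from (B1-F)**: `PairArrayAtV17F … n` + the smallness line `D·|U| ≤ 1/10` (`D = C_W + klLegKappa·Q.CR·Klam³`) give, for every `Qm`, the bound
`‖klPairArrayF … n Qm s t‖ ≤ m′ := 2|U| + D·U²` with `0 ≤ m′`, `m′² ≤ 2⁸·(Klam U)²` (`m′ ≤ 2.1|U|`, `Klam ≥ 1`). -/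
theorem rowC_pairArray_apriori (hP : P.WF) (hQ : 0 ≤ Q.CR) (hcU' : (P.C_W + klLegKappa * Q.CR * P.Klam ^ 3) * |U| ≤ 1 / 10)
    (harr : PairArrayAtV17F L M P Q β U μ n) (Qm : TorusSite 2 L) :
    ∃ m' : ℝ, 0 ≤ m' ∧ m' ^ 2 ≤ 2 ^ 8 * (P.Klam * U) ^ 2 ∧ ∀ s t, ‖klPairArrayF L M β U μ n Qm s t‖ ≤ m' := by
  set D := P.C_W + klLegKappa * Q.CR * P.Klam ^ 3 with hD
  have hD0 : 0 ≤ D := klValTol_nonneg hP hQ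
  obtain ⟨u, hu0, hu2, hball⟩ := harr Qm
  have hK1 : 1 ≤ P.Klam := hP.1
  have hUa : 0 ≤ |U| := abs_nonneg U
  have hDU2 : D * U ^ 2 ≤ |U| / 10 := by
    have : D * U ^ 2 = D * |U| * |U| := by rw [← sq_abs]; ring
    rw [this]; nlinarith
  refine ⟨2 * |U| + D * U ^ 2, by positivity, ?_, ?_⟩
  · have hm : 2 * |U| + D * U ^ 2 ≤ 21 / 10 * |U| := by linarith
    have hm0 : 0 ≤ 2 * |U| + D * U ^ 2 := by positivity
    have hKU : |U| ≤ P.Klam * |U| := by nlinarith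
    calc (2 * |U| + D * U ^ 2) ^ 2 ≤ (21 / 10 * |U|) ^ 2 := pow_le_pow_left₀ hm0 hm 2
      _ ≤ 2 ^ 8 * (P.Klam * |U|) ^ 2 := by nlinarith [sq_nonneg (P.Klam * |U|), sq_nonneg |U|]
      _ = 2 ^ 8 * (P.Klam * U) ^ 2 := by rw [mul_pow, mul_pow, sq_abs]
  · intro s t
    by_cases hs : s ∈ klBall L μ 0
    · by_cases ht : t ∈ klBall L μ 0
      · rw [klPairArrayF_apply_of_mem L M β U μ n Qm hs ht]
        have h1 := hball s hs t ht
        have hu : ‖(u : ℂ)‖ = u := by rw [Complex.norm_real, Real.norm_eq_abs, abs_of_nonneg hu0]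
        calc ‖klPairAmplitude L M β U μ (klFlowFrameU L M β U μ n) n Qm s t‖
            = ‖(klPairAmplitude L M β U μ (klFlowFrameU L M β U μ n) n Qm s t - (u : ℂ)) + (u : ℂ)‖ := by rw [sub_add_cancel]
          _ ≤ ‖klPairAmplitude L M β U μ (klFlowFrameU L M β U μ n) n Qm s t - (u : ℂ)‖ + ‖(u : ℂ)‖ := norm_add_le _ _
          _ ≤ D * U ^ 2 + 2 * |U| := by rw [hu]; exact add_le_add h1 hu2
          _ = 2 * |U| + D * U ^ 2 := by ring
      · rw [klPairArrayF_apply_of_not_mem_right L M β U μ n Qm s ht, norm_zero]; positivity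
    · rw [klPairArrayF_apply_of_not_mem L M β U μ n Qm hs t, norm_zero]; positivity

/-- **The un-smearing smallness `m′·Σ_p|tₙ[s_{n,n+1}](Qm,p)| ≤ 1/3`** (`unsmear_smallness_of_le`) under row (c)'s doors: `FrameOK` of the lower frame, `klBetaMin ≤ β ≤ L`,
`m′² ≤ 2⁸(KlamU)²`, `Klam·U ≤ 1/(3·2²⁰)`. -/
theorem rowC_hsm {R : RenConsts} {N : ℕ} (hK : FrameOK R U N μ (klFlowFrameU L M β U μ n)) (hβ : klBetaMin ≤ β) (hβL : β ≤ L)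
    {m' : ℝ} (hm'K : m' ^ 2 ≤ 2 ^ 8 * (P.Klam * U) ^ 2) (hKU0 : 0 ≤ P.Klam * U) (hKU : P.Klam * U ≤ 1 / (3 * 2 ^ 20)) (Qm : TorusSite 2 L) :
    m' * ∑ p, |klTransferWeight L M β μ (klFlowFrameU L M β U μ n) n
      (softSymbolCompl L M β μ (klFlowFrameU L M β U μ n) n (n + 1)) Qm p| ≤ 1 / 3 :=
  unsmear_smallness_of_le hK hβ hβL n (fun k => softSymbolCompl_succ_soft (L := L) (M := M) β μ (klFlowFrameU L M β U μ n) n k) hm'K hKU0 hKU Qm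

end Apriori

/-! ## §4 The erem host line at the registered tokens -/

section Host

variable {P : SplitConsts} {R : RenConsts} {c U β : ℝ}

/-- **`hE` at `(klEngGeo14, klEngQ9dG klEngGeo14 P R)`**: with `r := klCT8 P R (klEngQ7 P R) klEngGeo14 klEngGeoTh` (`0 ≤ r ≤ 2²⁰(1+klTS)`) and the share `s = ¼`,
`2·¼·eremBar klEngGeo11 P Q U β L n + (2r·15367·(KlamU)²/L + 4r·15367·(Klam|U|)³·2^{−(n+1)}) ≤ eremBar klEngGeo14 P Q U β L n` — `hout_hE_cap_of_U` (u-slot `klCTu8T`,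
`Q`-floors of §1) and `eremBar_klEngGeo14_eq`. -/
theorem rowC_hE_klEngGeo14 (hP : P.WF) (hU : 0 < U) (hUle : U ≤ klEngU₀12GQ klEngGeo14 (klEngQ9dG klEngGeo14 P R) P R c) (L n : ℕ) :
    2 * 4⁻¹ * eremBar klEngGeo11 P (klEngQ9dG klEngGeo14 P R) U β L n +
        (2 * klCT8 P R (klEngQ7 P R) klEngGeo14 klEngGeoTh * 15367 * ((P.Klam * U) ^ 2 * ((L : ℝ))⁻¹) +
          4 * klCT8 P R (klEngQ7 P R) klEngGeo14 klEngGeoTh * 15367 * ((P.Klam * |U|) ^ 3 * ((2 : ℝ) ^ (n + 1))⁻¹)) ≤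
      eremBar klEngGeo14 P (klEngQ9dG klEngGeo14 P R) U β L n := by
  rw [eremBar_klEngGeo14_eq]
  exact hout_hE_cap_of_U hP R (klEngQ9dG_wf klEngGeo14 P R) L n (klCT8_nonneg P R (klEngQ7 P R) klEngGeo14 klEngGeoTh)
    (klCT8_le_cap P R (klEngQ7 P R) klEngGeo14 klEngGeoTh) (rowC_klam_mul_le klEngGeo14 hP hU hUle).2.2 (rowC_hTU klEngGeo14 hU hUle)
    (rowC_hQCR klEngGeo14 P R) (rowC_hQCL klEngGeo14 P R β n)

end Host

end Summit.HubbardSuperconductivity.HubbardSuperconductivity.Theorems.EngineV8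

end
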